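import Summits.FinalStateConjecture.FinalStateConjecture.Theorems.ClusterCompletenessOmegaLimitMultiKerrJointFlatOmegaLimits
import Summits.FinalStateConjecture.FinalStateConjecture.Theorems.ClusterCompletenessOmegaLimitMultiKerrTranslates
import Literature.Geometry.Lorentzian.BilinPullbackEstimates
import HarnessLib

/-!
# Route ClusterCompleteness · crux `OmegaLimitMultiKerr` — joint flat ω-limits of the N HOLE CHARTS
# of a recurring, tame configuration (the crux-level form of the LaSalle reading)

Structure lemma for the crux stmt-FinalStateConjecture-14664 (`ClusterCompleteness.OmegaLimitMultiKerr`,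
rank 9), line `Sketch`, lead gen 3. The sequential form of the recur-disjunct
(`recurs_iff_exists_seq`) hands over, for one maximal development, `N` hole charts
`Ψᵢ : boostedKerrExterior (mo i).1 (mo i).2 (M i) (a i) → 𝒟` and ONE sequence of chart times
`T n → ∞` along which every `truncDeviationCk … (Ψ i) k R' (T n)` tends to `0` (every hole, every
radius). This file reads that clause through the landed dictionary: if the hole charts are TAME at
order `k + 1` (finite `C^{k+1}` size of each deviation on every truncated late region — the generic
stub of the recommended re-line), then along ONE common subsequence every hole's translated deviation
`x ↦ (Ψᵢ^* g − g_{Mᵢ,aᵢ})(x + T (φ n) • Λᵢ∂₀)` converges in `Cᵏ` on compacts of its exterior to an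
ω-limit `gᵢ` which is FLAT TO ORDER `k` on the time-zero slab `{t*ᵢ = 0}`: the reference multi-Kerr
configuration is a JOINT ω-limit point of the charted geometry (`exists_strictMono_forall_omegaLimit_flat`
specialised hole by hole exactly as `exists_omegaLimit_hole_translate`; Hale 1980, Ch. I, §8).
-/

-- every `Summit.FinalStateConjecture.FinalStateConjecture.…` name repeats the summit = sub-problem segment (D-0017 layout)
set_option linter.dupNamespace false

noncomputable section

open scoped Manifold ContDiff Topology ENNReal
open Set Filter TopologicalSpace

namespace Summit.FinalStateConjecture.FinalStateConjecture.Theorems.ClusterCompleteness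

open Literature.Geometry.Lorentzian

/-- **Joint flat ω-limits of the hole charts of a recurring tame configuration.** For `N` smooth
hole charts `Ψᵢ` on `boostedKerrBackground (mo i).1 (mo i).2 (M i) (a i)`, tame at order `k + 1`
after `τ₀` (finite `C^{k+1}` sup norm of each deviation over every truncated late region), and ONE
sequence `T n → ∞` along which EVERY hole recurs at EVERY radius
(`truncDeviationCk … (Ψ i) k R' (T n) → 0`), one common strictly increasing `φ` gives every hole a
`Cᵏ` ω-limit `gᵢ` of its `Λᵢ∂₀`-translated deviation on compacts of its exterior, all of whose
derivatives of order `≤ k` vanish on `{t*ᵢ = 0}` (Hale 1980, Ch. I, §8). [cite: Hale1980, Ch. I §8] -/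
theorem exists_strictMono_forall_hole_omegaLimit_flat :
    ∀ (𝓢 : Spacetime 4) (N : ℕ) (mo : Fin N → lorentzGroup × E4) (M a : Fin N → ℝ)
      (Ψ : ∀ i, (boostedKerrBackground (mo i).1 (mo i).2 (M i) (a i)).domain → 𝓢.carrier),
      (∀ i, ContMDiff 𝓘(ℝ, E4) (𝓡 4) ∞ (Ψ i)) →
      ∀ {k : ℕ} {τ₀ : ℝ}, (∀ i (R : ℝ),
        supCkENorm (Subtype.val ''
          (boostedKerrBackground (mo i).1 (mo i).2 (M i) (a i)).truncLateRegion τ₀ R) (k + 1)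
          (𝓢.deviationExtend (boostedKerrBackground (mo i).1 (mo i).2 (M i) (a i)) (Ψ i)) ≠ ⊤) →
      ∀ {T : ℕ → ℝ}, Tendsto T atTop atTop →
      (∀ i (R' : ℝ), Tendsto (fun n ↦ 𝓢.truncDeviationCk
        (boostedKerrBackground (mo i).1 (mo i).2 (M i) (a i)) (Ψ i) k R' (T n)) atTop (𝓝 0)) →
      ∃ φ : ℕ → ℕ, StrictMono φ ∧ ∀ i, ∃ g : E4 → E4 →L[ℝ] E4 →L[ℝ] ℝ,
        ContDiffOn ℝ k g (boostedKerrExterior (mo i).1 (mo i).2 (M i) (a i) : Set E4) ∧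
        (∀ K ⊆ (boostedKerrExterior (mo i).1 (mo i).2 (M i) (a i) : Set E4), IsCompact K →
          Tendsto (fun n ↦ supCkENorm K k (fun x ↦
            𝓢.deviationExtend (boostedKerrBackground (mo i).1 (mo i).2 (M i) (a i)) (Ψ i)
              (x + T (φ n) • ((mo i).1 : E4 ≃L[ℝ] E4) (EuclideanSpace.single (0 : Fin 4) (1 : ℝ))) -
              g x)) atTop (𝓝 0)) ∧
        ∀ x ∈ Subtype.val '' (boostedKerrBackground (mo i).1 (mo i).2 (M i) (a i)).timeSlab 0,
          ∀ m, m ≤ k → iteratedFDeriv ℝ m g x = 0 := by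
  intro 𝓢 N mo M a Ψ hΨ k τ₀ hfin T hT hrec
  -- the N systems `(Bᵢ, eᵢ, hᵢ)`
  refine exists_strictMono_forall_omegaLimit_flat N
    (fun i ↦ boostedKerrBackground (mo i).1 (mo i).2 (M i) (a i))
    (fun i ↦ ((mo i).1 : E4 ≃L[ℝ] E4) (EuclideanSpace.single (0 : Fin 4) (1 : ℝ)))
    (fun i ↦ add_smul_mem_boostedKerrBackground_domain (mo i).1 (mo i).2 (M i) (a i))
    (fun i ↦ KerrSchildChart.time_add_smul (mo i).1 (mo i).2 (M i) (a i))
    (fun i ↦ KerrSchildChart.radius_add_smul (mo i).1 (mo i).2 (M i) (a i))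
    (fun i ↦ (PiLp.continuous_apply 2 _ 0).comp (continuous_poincareInv (mo i).1 (mo i).2))
    (fun i ↦ (Kerr.continuous_radius (a i)).comp (continuous_poincareInv (mo i).1 (mo i).2))
    (h := fun i ↦ 𝓢.deviationExtend (boostedKerrBackground (mo i).1 (mo i).2 (M i) (a i)) (Ψ i))
    (fun i ↦ (contDiffOn_deviationExtend_boostedKerr 𝓢 (hΨ i)).of_le (by exact_mod_cast le_top))
    (τ₀ := τ₀)
    (fun i R ↦ ⟨_, fun _ hj _ hx ↦ norm_iteratedFDeriv_le_toReal_supCkENorm hj hx _ (hfin i R)⟩)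
    hT fun i R' ↦ ?_
  -- the recurrence clause in translate form
  exact (hrec i R').congr fun n ↦
    truncDeviationCk_eq_supCkENorm_translate 𝓢 (mo i).1 (mo i).2 (M i) (a i) (Ψ i) k R' (T n)

end Summit.FinalStateConjecture.FinalStateConjecture.Theorems.ClusterCompleteness

end
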